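/-
Copyright (c) 2026 the pub-hodgecm-mathlib formalisation cell (harness21).  Prover seat hodgecm-mathlib-K2E3-p25 (g2), HCML Track B «K2-LIT»,
h413 = `stmt-HodgeConjecture-24833`, road (11-3-split-nsc), leaf (nsc-S-A′), brick (E4b-1γ, part 2a = ALGEBRA of the open cell) of the weak cell lemma (dealer D105′).
2026-09-04.
-/
import Literature.NumberTheory.Automorphic.InducedWhittakerVanishing     -- ★ `permGL`, `coe_permGL_mul_mul_inv`, `vanishingOn`
import Literature.NumberTheory.Automorphic.WhittakerSupportFinite        -- ★ `transvectionUnit`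
import Literature.NumberTheory.Automorphic.ParabolicGL                   -- ★ `standardParabolicGL`, `unipotentRadicalGL`, `blockDiagonalGL`
import Summits.HodgeConjecture.HodgeConjecture.Theorems.K2E3GL3OuterAutomorphismInduction   -- ★ T1 entry lemmas `apply_eq_of_mem_unipotentRadicalGL`, `mem_unipotentRadicalGL_of_apply`
import HarnessLib

/-!
# K2_E3 road (h413), leaf (nsc-S-A′), brick E4b-1γ part 2a — algebra of the open `(B, P_{(2,1)})`-cell of `GL₃`: `w`, `n(v)`, `diag(g,1)`

Cell `pub/hodgecm-mathlib` (D-0151), Track B, seat K2E3-p25 (g2).  `--supports stmt-HodgeConjecture-24833 --as helper`; THEOREMS ONLY (no `def`, no instance, no notation,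
no `sorry`); never imports `Cruxes/…/Lines`.  COUNT-NEUTRAL.

THE MATHEMATICS ([BernsteinZelevinsky1977, §5 (Thm. 5.2)]; [Casselman1995, §6.3]).  `c = ![0,0,1]`, `P = P_c`, `U_P = {n(v) = 1 + v₀E₀₂ + v₁E₁₂}`,
`w = P_σ` for `σ = (0 ↦ 2, 1 ↦ 0, 2 ↦ 1)` (`(wA)₀ = A₂, (wA)₁ = A₀, (wA)₂ = A₁`), `ι̂(g) = diag(g, 1)` (the hypothesis `hι` of K2E3-p03's letters).  All entrywise, all `rfl`∕`simp`:
* §1 `n(a,b) = t₀₂(a)·t₁₂(b)`: entries (`uP_apply`), `n(a+a′,b+b′) = n(a,b)n(a′,b′)` (`uP_add`), `n(v) ∈ U_P` (`uP_mem_unipotentRadicalGL`), every `u ∈ U_P` is an `n(v)`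
  (`exists_eq_uP`), continuity of `v ↦ n(v)`;
* §2 `ι̂`: `n(v)·ι̂(g) = ι̂(g)·n(g⁻¹v)` (`uP_mul_diag`), `w·ι̂(b)·w⁻¹ ∈ B` for `b` upper triangular and `∈ U₃` for `b` upper unitriangular (`conj_w_diag_mem_borel∕_upperUnitriangular`);
* §3 entries of `h = w·n(v)·ι̂(g)`: rows `1, 2` are `(g₀₀, g₀₁, v₀)`, `(g₁₀, g₁₁, v₁)` — so the minor `m(h) = det g`, `h₁₂ = v₀`, `h₂₂ = v₁` (the shape consumed by ★ part 1
  `toFun_eq_zero_of_entry_large`).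

HONEST LABEL: HC_CM is proved only modulo the 7 printed citations (2 remaining named inputs: hLiu418 = stmt-HodgeConjecture-24832, h413 = stmt-HodgeConjecture-24833) until rung 0
closes; count-neutral helper.

## References
* [BernsteinZelevinsky1977] I. N. Bernstein, A. V. Zelevinsky, *Induced representations of reductive p-adic groups I*, Ann. Sci. ÉNS 10 (1977), §5.
* [Casselman1995] W. Casselman, *Introduction to the theory of admissible representations of p-adic reductive groups* (draft 1995), §6.3.
-/

set_option autoImplicit false
set_option linter.dupNamespace false

noncomputable section

open Function
open scoped MatrixGroups
open Literature.NumberTheory.Automorphic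
open Summit.HodgeConjecture.HodgeConjecture.Cruxes.H413.K2E3GL3OuterAutomorphismInduction

namespace Summit.HodgeConjecture.HodgeConjecture.Cruxes.H413.K2E3GL3BorelInducedJacquetQOpenCellAlgebra

variable {F : Type} [Field F] [ValuativeRel F] [TopologicalSpace F] [IsNonarchimedeanLocalField F]

/-! ## §1 The unipotent radical `U_P = {n(a,b)}` -/

section UP

-- The two root positions of `U_P`; stated with named proofs `h02 : 0 ≠ 2`, `h12 : 1 ≠ 2` so that every file rewrites with the same terms.
variable (h02 : (0 : Fin 3) ≠ 2) (h12 : (1 : Fin 3) ≠ 2)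

omit [ValuativeRel F] [TopologicalSpace F] [IsNonarchimedeanLocalField F] in
/-- Entries of **`n(a,b) = t₀₂(a)·t₁₂(b) = 1 + aE₀₂ + bE₁₂`**. [folklore] -/
theorem uP_apply (a b : F) (i j : Fin 3) :
    ((transvectionUnit 0 2 h02 a * transvectionUnit 1 2 h12 b : GL (Fin 3) F) : Matrix (Fin 3) (Fin 3) F) i j =
      (if i = j then 1 else 0) + (if 0 = i ∧ 2 = j then a else 0) + (if 1 = i ∧ 2 = j then b else 0) := by
  rw [Units.val_mul, coe_transvectionUnit, coe_transvectionUnit]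
  fin_cases i <;> fin_cases j <;> simp [Matrix.mul_apply, Fin.sum_univ_three, Matrix.single_apply, Matrix.one_apply]

omit [ValuativeRel F] [TopologicalSpace F] [IsNonarchimedeanLocalField F] in
/-- **`n(a + a′, b + b′) = n(a,b)·n(a′,b′)`** (`U_P ≅ F²` is abelian). [folklore] -/
theorem uP_add (a b a' b' : F) :
    (transvectionUnit 0 2 h02 (a + a') * transvectionUnit 1 2 h12 (b + b') : GL (Fin 3) F) =
      (transvectionUnit 0 2 h02 a * transvectionUnit 1 2 h12 b) * (transvectionUnit 0 2 h02 a' * transvectionUnit 1 2 h12 b') := by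
  refine Units.ext (Matrix.ext fun i j => ?_)
  conv_rhs => rw [Units.val_mul, Matrix.mul_apply, Fin.sum_univ_three]
  simp only [uP_apply]
  fin_cases i <;> fin_cases j <;> simp [add_comm]

omit [ValuativeRel F] [TopologicalSpace F] [IsNonarchimedeanLocalField F] in
/-- **`n(a,b) ∈ U_P`** for `P = P_{![0,0,1]}`. [folklore] -/
theorem uP_mem_unipotentRadicalGL (a b : F) :
    (transvectionUnit 0 2 h02 a * transvectionUnit 1 2 h12 b : GL (Fin 3) F) ∈ unipotentRadicalGL F (![0, 0, 1] : Fin 3 → Fin 2) := by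
  refine mem_unipotentRadicalGL_of_apply _ (fun i j hij => ?_) (fun i j hij => ?_)
  · rw [uP_apply]
    fin_cases i <;> fin_cases j <;> simp_all
  · rw [uP_apply]
    fin_cases i <;> fin_cases j <;> simp_all

omit [ValuativeRel F] [TopologicalSpace F] [IsNonarchimedeanLocalField F] in
/-- `U_P ≤ U₃` (the upper unitriangular group): `n(a,b) ∈ U₃`. [folklore] -/
theorem uP_mem_upperUnitriangular (a b : F) :
    (transvectionUnit 0 2 h02 a * transvectionUnit 1 2 h12 b : GL (Fin 3) F) ∈ upperUnitriangular (Fin 3) F := by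
  refine mem_unipotentRadicalGL_of_apply _ (fun i j hij => ?_) (fun i j hij => ?_)
  · rw [uP_apply]
    fin_cases i <;> fin_cases j <;> simp_all
  · rw [uP_apply]
    have hij' : i = j := hij
    subst hij'
    fin_cases i <;> simp

omit [ValuativeRel F] [TopologicalSpace F] [IsNonarchimedeanLocalField F] in
/-- **Every `u ∈ U_P` is an `n(a,b)`**, namely `(a,b) = (u₀₂, u₁₂)`. [folklore] -/
theorem exists_eq_uP {u : GL (Fin 3) F} (hu : u ∈ unipotentRadicalGL F (![0, 0, 1] : Fin 3 → Fin 2)) :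
    ∃ a b : F, u = transvectionUnit 0 2 h02 a * transvectionUnit 1 2 h12 b := by
  refine ⟨(u : Matrix (Fin 3) (Fin 3) F) 0 2, (u : Matrix (Fin 3) (Fin 3) F) 1 2, Units.ext (Matrix.ext fun i j => ?_)⟩
  have hlow := fun i j (h : (![0, 0, 1] : Fin 3 → Fin 2) j < ![0, 0, 1] i) => unipotentRadicalGL_le F _ hu h
  have hdiag := fun i j (h : (![0, 0, 1] : Fin 3 → Fin 2) i = ![0, 0, 1] j) => apply_eq_of_mem_unipotentRadicalGL _ hu i j h
  rw [uP_apply]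
  fin_cases i <;> fin_cases j
  · simpa using hdiag 0 0 (by decide)
  · simpa using hdiag 0 1 (by decide)
  · simp
  · simpa using hdiag 1 0 (by decide)
  · simpa using hdiag 1 1 (by decide)
  · simp
  · simpa using hlow 2 0 (by decide)
  · simpa using hlow 2 1 (by decide)
  · simpa using hdiag 2 2 (by decide)

/-- **Continuity of `α ↦ t_{ij}(α)`**. [folklore] -/
theorem continuous_transvectionUnit (i j : Fin 3) (hij : i ≠ j) : Continuous fun α : F => (transvectionUnit i j hij α : GL (Fin 3) F) := by
  haveI : IsTopologicalRing F := inferInstance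
  have hsingle : ∀ s : F → F, Continuous s → Continuous fun α : F => (1 : Matrix (Fin 3) (Fin 3) F) + Matrix.single i j (s α) := by
    intro s hs
    refine continuous_const.add (continuous_matrix fun i' j' => ?_)
    simp only [Matrix.single_apply]
    split_ifs
    · exact hs
    · exact continuous_const
  refine Units.continuous_iff.2 ⟨?_, ?_⟩
  · change Continuous fun α : F => (1 : Matrix (Fin 3) (Fin 3) F) + Matrix.single i j α
    exact hsingle id continuous_id
  · change Continuous fun α : F => (((transvectionUnit i j hij α)⁻¹ : GL (Fin 3) F) : Matrix (Fin 3) (Fin 3) F)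
    simp_rw [transvectionUnit_inv, coe_transvectionUnit]
    exact hsingle (fun α => -α) continuous_neg

/-- **Continuity of `v ↦ n(v₀, v₁)`** on `F²`. [folklore] -/
theorem continuous_uP : Continuous fun v : Fin 2 → F => (transvectionUnit 0 2 h02 (v 0) * transvectionUnit 1 2 h12 (v 1) : GL (Fin 3) F) :=
  ((continuous_transvectionUnit 0 2 h02).comp (continuous_apply 0)).mul ((continuous_transvectionUnit 1 2 h12).comp (continuous_apply 1))

/-! ## §2 The block `ι̂(g) = diag(g, 1)` -/

variable (D : GL (Fin 2) F → GL (Fin 3) F)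
  (hD : ∀ g : GL (Fin 2) F, ((D g : GL (Fin 3) F) : Matrix (Fin 3) (Fin 3) F) =
    !![(g : Matrix (Fin 2) (Fin 2) F) 0 0, (g : Matrix (Fin 2) (Fin 2) F) 0 1, 0;
       (g : Matrix (Fin 2) (Fin 2) F) 1 0, (g : Matrix (Fin 2) (Fin 2) F) 1 1, 0;
       0, 0, 1])

omit [ValuativeRel F] [TopologicalSpace F] [IsNonarchimedeanLocalField F] in
include hD in
/-- **`n(v)·ι̂(g) = ι̂(g)·n(g⁻¹v)`** (`ι̂(g)⁻¹ n(v) ι̂(g) = n(g⁻¹ v)`): the adjoint action of the `GL₂` block on `U_P ≅ F²` is the standard one. [cite: BernsteinZelevinsky1977, §5] -/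
theorem uP_mul_diag (v : Fin 2 → F) (g : GL (Fin 2) F) :
    (transvectionUnit 0 2 h02 (v 0) * transvectionUnit 1 2 h12 (v 1) : GL (Fin 3) F) * D g =
      D g * (transvectionUnit 0 2 h02 ((((g⁻¹ : GL (Fin 2) F) : Matrix (Fin 2) (Fin 2) F).mulVec v) 0) *
        transvectionUnit 1 2 h12 ((((g⁻¹ : GL (Fin 2) F) : Matrix (Fin 2) (Fin 2) F).mulVec v) 1)) := by
  -- `g · (g⁻¹ v) = v`
  have hgv : ((g : GL (Fin 2) F) : Matrix (Fin 2) (Fin 2) F).mulVec (((g⁻¹ : GL (Fin 2) F) : Matrix (Fin 2) (Fin 2) F).mulVec v) = v := by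
    rw [Matrix.mulVec_mulVec, ← Units.val_mul, mul_inv_cancel, Units.val_one, Matrix.one_mulVec]
  set u := ((g⁻¹ : GL (Fin 2) F) : Matrix (Fin 2) (Fin 2) F).mulVec v with hu
  have h0 : (g : Matrix (Fin 2) (Fin 2) F) 0 0 * u 0 + (g : Matrix (Fin 2) (Fin 2) F) 0 1 * u 1 = v 0 := by
    have := congrFun hgv 0; simpa [Matrix.mulVec, dotProduct, Fin.sum_univ_two] using this
  have h1 : (g : Matrix (Fin 2) (Fin 2) F) 1 0 * u 0 + (g : Matrix (Fin 2) (Fin 2) F) 1 1 * u 1 = v 1 := by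
    have := congrFun hgv 1; simpa [Matrix.mulVec, dotProduct, Fin.sum_univ_two] using this
  refine Units.ext (Matrix.ext fun i j => ?_)
  have hL : ((((transvectionUnit 0 2 h02 (v 0) * transvectionUnit 1 2 h12 (v 1)) * D g : GL (Fin 3) F)) : Matrix (Fin 3) (Fin 3) F) i j =
      ∑ k : Fin 3, ((transvectionUnit 0 2 h02 (v 0) * transvectionUnit 1 2 h12 (v 1) : GL (Fin 3) F) : Matrix (Fin 3) (Fin 3) F) i k *
        ((D g : GL (Fin 3) F) : Matrix (Fin 3) (Fin 3) F) k j := by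
    rw [Units.val_mul, Matrix.mul_apply]
  have hR : (((D g * (transvectionUnit 0 2 h02 (u 0) * transvectionUnit 1 2 h12 (u 1)) : GL (Fin 3) F)) : Matrix (Fin 3) (Fin 3) F) i j =
      ∑ k : Fin 3, ((D g : GL (Fin 3) F) : Matrix (Fin 3) (Fin 3) F) i k *
        ((transvectionUnit 0 2 h02 (u 0) * transvectionUnit 1 2 h12 (u 1) : GL (Fin 3) F) : Matrix (Fin 3) (Fin 3) F) k j := by
    rw [Units.val_mul, Matrix.mul_apply]
  rw [hL, hR, Fin.sum_univ_three, Fin.sum_univ_three]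
  simp only [uP_apply, hD]
  fin_cases i <;> fin_cases j <;> simp [h0, h1]

end UP

/-! ## §3 The cell representative `w = P_σ`, `σ = (0 ↦ 2, 1 ↦ 0, 2 ↦ 1)` -/

section W

variable (h02 : (0 : Fin 3) ≠ 2) (h12 : (1 : Fin 3) ≠ 2)

omit [ValuativeRel F] [TopologicalSpace F] [IsNonarchimedeanLocalField F] in
/-- **`(w·A)_{ij} = A_{σ i, j}`** for `w = P_σ` (★ `permGL`). [folklore] -/
theorem coe_permGL_mul_apply (σ : Equiv.Perm (Fin 3)) (A : GL (Fin 3) F) (i j : Fin 3) :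
    ((permGL σ * A : GL (Fin 3) F) : Matrix (Fin 3) (Fin 3) F) i j = (A : Matrix (Fin 3) (Fin 3) F) (σ i) j := by
  rw [Units.val_mul, coe_permGL, Equiv.Perm.permMatrix, PEquiv.toMatrix_toPEquiv_mul, Matrix.submatrix_apply, id]

variable (D : GL (Fin 2) F → GL (Fin 3) F)
  (hD : ∀ g : GL (Fin 2) F, ((D g : GL (Fin 3) F) : Matrix (Fin 3) (Fin 3) F) =
    !![(g : Matrix (Fin 2) (Fin 2) F) 0 0, (g : Matrix (Fin 2) (Fin 2) F) 0 1, 0;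
       (g : Matrix (Fin 2) (Fin 2) F) 1 0, (g : Matrix (Fin 2) (Fin 2) F) 1 1, 0;
       0, 0, 1])

include hD in
omit [ValuativeRel F] [TopologicalSpace F] [IsNonarchimedeanLocalField F] in
/-- **Entries of the cell point `h = w·n(a,b)·ι̂(g)`** (`w = P_σ`, `σ = (1 2)(0 1) = (0 ↦ 2, 1 ↦ 0, 2 ↦ 1)`): rows `1, 2` of `h` are `(g₀₀, g₀₁, a)` and `(g₁₀, g₁₁, b)`; row `0` is `(0,0,1)`.
[cite: BernsteinZelevinsky1977, §5] -/
theorem cellPoint_apply (a b : F) (g : GL (Fin 2) F) (i j : Fin 3) :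
    ((permGL (Equiv.swap (1 : Fin 3) 2 * Equiv.swap 0 1) * (transvectionUnit 0 2 h02 a * transvectionUnit 1 2 h12 b) * D g : GL (Fin 3) F) : Matrix (Fin 3) (Fin 3) F) i j =
      !![(0 : F), 0, 1; (g : Matrix (Fin 2) (Fin 2) F) 0 0, (g : Matrix (Fin 2) (Fin 2) F) 0 1, a;
         (g : Matrix (Fin 2) (Fin 2) F) 1 0, (g : Matrix (Fin 2) (Fin 2) F) 1 1, b] i j := by
  have hA : ∀ i' j', (((transvectionUnit 0 2 h02 a * transvectionUnit 1 2 h12 b) * D g : GL (Fin 3) F) : Matrix (Fin 3) (Fin 3) F) i' j' =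
      ∑ k : Fin 3, ((transvectionUnit 0 2 h02 a * transvectionUnit 1 2 h12 b : GL (Fin 3) F) : Matrix (Fin 3) (Fin 3) F) i' k *
        ((D g : GL (Fin 3) F) : Matrix (Fin 3) (Fin 3) F) k j' := fun i' j' => by rw [Units.val_mul, Matrix.mul_apply]
  rw [mul_assoc, coe_permGL_mul_apply, hA, Fin.sum_univ_three]
  simp only [uP_apply, hD]
  fin_cases i <;> fin_cases j <;> simp [Equiv.Perm.mul_apply, Equiv.swap_apply_def]

include hD in
omit [ValuativeRel F] [TopologicalSpace F] [IsNonarchimedeanLocalField F] in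
/-- **The minor of the cell point is `det g`** — so `w·n(a,b)·ι̂(g)` lies in the open cell `{m ≠ 0}`. [cite: BernsteinZelevinsky1977, §5] -/
theorem minor_cellPoint (a b : F) (g : GL (Fin 2) F) :
    ((permGL (Equiv.swap (1 : Fin 3) 2 * Equiv.swap 0 1) * (transvectionUnit 0 2 h02 a * transvectionUnit 1 2 h12 b) * D g : GL (Fin 3) F) : Matrix (Fin 3) (Fin 3) F) 1 0 *
        ((permGL (Equiv.swap (1 : Fin 3) 2 * Equiv.swap 0 1) * (transvectionUnit 0 2 h02 a * transvectionUnit 1 2 h12 b) * D g : GL (Fin 3) F) : Matrix (Fin 3) (Fin 3) F) 2 1 -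
      ((permGL (Equiv.swap (1 : Fin 3) 2 * Equiv.swap 0 1) * (transvectionUnit 0 2 h02 a * transvectionUnit 1 2 h12 b) * D g : GL (Fin 3) F) : Matrix (Fin 3) (Fin 3) F) 1 1 *
        ((permGL (Equiv.swap (1 : Fin 3) 2 * Equiv.swap 0 1) * (transvectionUnit 0 2 h02 a * transvectionUnit 1 2 h12 b) * D g : GL (Fin 3) F) : Matrix (Fin 3) (Fin 3) F) 2 0 =
      (g : Matrix (Fin 2) (Fin 2) F).det := by
  simp only [cellPoint_apply h02 h12 D hD, Matrix.det_fin_two]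
  simp

include hD in
omit [ValuativeRel F] [TopologicalSpace F] [IsNonarchimedeanLocalField F] in
/-- **`w·ι̂(g)·w⁻¹` is upper triangular for `g` upper triangular** (`w ι̂(g) w⁻¹ = diag(1, g)` in block form). [cite: BernsteinZelevinsky1977, §5] -/
theorem conj_permGL_diag_mem_borel {g : GL (Fin 2) F} (hg : g ∈ standardParabolicGL F (id : Fin 2 → Fin 2)) :
    permGL (Equiv.swap (1 : Fin 3) 2 * Equiv.swap 0 1) * D g * (permGL (Equiv.swap (1 : Fin 3) 2 * Equiv.swap 0 1))⁻¹ ∈ standardParabolicGL F (id : Fin 3 → Fin 3) := by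
  rw [mem_standardParabolicGL_iff] at hg ⊢
  intro i j hij
  rw [coe_permGL_mul_mul_inv, Matrix.submatrix_apply, hD]
  have h10 : (g : Matrix (Fin 2) (Fin 2) F) 1 0 = 0 := hg (show (id : Fin 2 → Fin 2) 0 < id 1 by decide)
  fin_cases i <;> fin_cases j <;> simp_all [Equiv.Perm.mul_apply, Equiv.swap_apply_def]

include hD in
omit [ValuativeRel F] [TopologicalSpace F] [IsNonarchimedeanLocalField F] in
/-- **`w·ι̂(u)·w⁻¹ ∈ U₃` for `u` upper unitriangular in `GL₂`.** [cite: BernsteinZelevinsky1977, §5] -/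
theorem conj_permGL_diag_mem_upperUnitriangular {u : GL (Fin 2) F} (hu : u ∈ upperUnitriangular (Fin 2) F) :
    permGL (Equiv.swap (1 : Fin 3) 2 * Equiv.swap 0 1) * D u * (permGL (Equiv.swap (1 : Fin 3) 2 * Equiv.swap 0 1))⁻¹ ∈ upperUnitriangular (Fin 3) F := by
  rw [mem_upperUnitriangular_iff] at hu ⊢
  obtain ⟨hu1, hu2⟩ := hu
  have h10 : (u : Matrix (Fin 2) (Fin 2) F) 1 0 = 0 := hu1 (show (id : Fin 2 → Fin 2) 0 < id 1 by decide)
  have h00 := hu2 0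
  have h11 := hu2 1
  refine ⟨fun i j hij => ?_, fun i => ?_⟩
  · rw [coe_permGL_mul_mul_inv, Matrix.submatrix_apply, hD]
    fin_cases i <;> fin_cases j <;> simp_all [Equiv.Perm.mul_apply, Equiv.swap_apply_def]
  · rw [coe_permGL_mul_mul_inv, Matrix.submatrix_apply, hD]
    fin_cases i <;> simp_all [Equiv.Perm.mul_apply, Equiv.swap_apply_def]

end W

end Summit.HodgeConjecture.HodgeConjecture.Cruxes.H413.K2E3GL3BorelInducedJacquetQOpenCellAlgebra

end
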